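import Mathlib
import Summits.NavierStokesRegularity.NavierStokesRegularity.Theorems.EulerZoomLiouvillePowerGaugeEulerLiouvilleSelfSimilarSublinearConfinement
import Summits.NavierStokesRegularity.NavierStokesRegularity.Theorems.EulerZoomLiouvillePowerGaugeEulerLiouvilleSelfSimilarBoundedLoc
import Summits.NavierStokesRegularity.NavierStokesRegularity.Theorems.EulerZoomLiouvillePowerGaugeEulerLiouvilleSelfSimilarHalfOrbitKill
import HarnessLib.Audit

/-!
# Rung C1 of the crux `EulerZoomLiouville.PowerGaugeEulerLiouville` (W3b portrait, 3/3): IN A `C²` SELF-SIMILAR EULER PROFILE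
# ALMOST EVERY VORTICAL FLUID PARTICLE COMES FROM INFINITY — vortical points with a bounded backward similarity orbit are null

Route №10 `EulerZoomLiouville` (NavierStokesRegularity), crux E = stmt-NavierStokesRegularity-19832, tenure rung C1,
registered residue `stub_selfSimilarExtremalRest`, sub-stratum W3b («`C²` profiles UNBOUNDED at infinity»).  Lineage
ns-typeII-p1 (gen 8).  A PORTRAIT theorem for the open `C²` residue (profiles of sparse linear-or-faster growth), with NO
growth hypothesis at all.

The cutoff localisation of the three-lineage argument (`Loc.curl_eq_zero_of_bounded` / `_of_sublinear` / `_of_subdrift`)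
uses the growth of the profile at infinity ONLY to confine the backward similarity orbits `t ↦ Φ_{−t} x` of the points
`x` near the point under study.  Run pointwise, the same argument says: **for every `N`, the set of VORTICAL points
(`curl U x ≠ 0`) admitting a backward `W`-half-orbit (`Y' = −W(Y)` on `[0,∞)`, `Y(0) = x`, `W = γy + U`) confined to the
ball `‖y‖ ≤ N` is Lebesgue-NULL** (`volume_vortical_confined_eq_zero`), hence so is the set of vortical points with a
bounded backward half-orbit (`volume_vortical_boundedBackward_eq_zero`).  Reading: in any `C²` self-similar Euler profile
with `0 < γ < ½`, almost every vortical fluid particle has an UNBOUNDED backward similarity trajectory — in physical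
variables, it sits at `|x| ≫ (−τ)^γ`, arbitrarily far outside the self-similar zone, at a sequence of times `τ → −∞`.
A refuting profile of the residue therefore needs a mechanism transporting vorticity in from spatial infinity (the
sparse fast spikes of the census); under any hypothesis confining backward orbits (bounded, `o(|y|)`, sub-drift growth)
the vortical set is null, open, hence empty — the closed strata.

Mechanism (pointwise in `x`, cutoff at radius `N + 1`): the backward half-orbit is re-parametrised as the globally
defined orbit of the cut-off field `χU` (ODE uniqueness inside the ball), the half-orbit kit `…SelfSimilarHalfOrbitKit` /
`…SelfSimilarHalfOrbitKill` (the trapped-trajectory lemmas and the limit-set kill with the ODE on `[0,∞)` only — without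
growth control the FORWARD orbit may blow up, so no global `W`-curve through `x` need exist) produces a bad stagnation
point in the limit set, the profile-free no-drift lemma `tendsto_flow_atBot_of_badClusterPt_loc` makes the orbit converge
to it, and the bad set inside the ball has a null backward basin (thin nodes, `…ThinSetsLoc` / p3's block data).

* `volume_vortical_confined_eq_zero` — `(U, P)` a `C²` profile of CIV (3.3), `0 < γ < ½`, `N > 0` ⇒
  `volume {x | curl U x ≠ 0 ∧ ∃ Y, Y 0 = x ∧ (∀ t ≥ 0, Y' t = −W(Y t)) ∧ ∀ t ≥ 0, ‖Y t‖ ≤ N} = 0`;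
* `volume_vortical_boundedBackward_eq_zero` — the same with `∃ N`;
* `ae_not_boundedBackward_of_curl_ne_zero` — a.e. form.

WHAT THIS IS NOT: not NS, not E, not rung C1, not a closure of any stratum — a structural constraint on the OPEN `C²`
residue. [folklore; ConstantinIgnatovaVicol2026Putative §3.4–§3.5 (setting: the self-similar Lagrangian flow and its
stagnation points)]
-/

noncomputable section

-- flat `Theorems/<Route><Decl>…` files of one crux share the namespace of the crux (tree convention)
set_option linter.dupNamespace false

open MeasureTheory Set Filter Topology Metric Function InnerProductSpace
open scoped RealInnerProductSpace NNReal ENNReal ContDiff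

namespace Summit.NavierStokesRegularity.NavierStokesRegularity.Theorems.PowerGaugeEulerLiouville.Loc

open Literature.Analysis Literature.Analysis.FluidPDE
open Summit.NavierStokesRegularity.NavierStokesRegularity.Theorems.PowerGaugeEulerLiouville.Kelvin

variable {γ : ℝ} {U : EuclideanSpace ℝ (Fin 3) → EuclideanSpace ℝ (Fin 3)} {P : EuclideanSpace ℝ (Fin 3) → ℝ}

/-- **VORTICAL POINTS WITH A CONFINED BACKWARD ORBIT ARE NULL.**  `(U, P)` a `C²` self-similar Euler profile (CIV (3.3)),
`0 < γ < ½`, `N > 0`: the set of points `x` with `curl U x ≠ 0` that admit a backward half-orbit of `W = γy + U`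
(`Y(0) = x`, `Y'(t) = −W(Y(t))` for `t ≥ 0`) staying in the ball `‖y‖ ≤ N` has Lebesgue measure zero.  No hypothesis on the
growth of `U`, the pressure, the far field or the stagnation set. [folklore; three-lineage chain of the ns-regularity-ideate
cell, run pointwise] -/
theorem volume_vortical_confined_eq_zero (hprof : IsSelfSimilarEulerProfile γ 0 U P)
    (hγ : 0 < γ) (hγ2 : γ < 1 / 2) {N : ℝ} (hN : 0 < N) :
    volume {x : EuclideanSpace ℝ (Fin 3) | curl U x ≠ 0 ∧
      ∃ Y : ℝ → EuclideanSpace ℝ (Fin 3), Y 0 = x ∧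
        (∀ t, 0 ≤ t → HasDerivAt Y ((-1 : ℝ) • selfSimilarTransport γ 0 U (Y t)) t) ∧
        ∀ t, 0 ≤ t → ‖Y t‖ ≤ N} = 0 := by
  have hU2 : ContDiff ℝ 2 U := hprof.contDiff_velocity
  have hU1 : ContDiff ℝ 1 U := hU2.of_le (by norm_num)
  have hγne : γ ≠ 1 / 2 := ne_of_lt hγ2
  set R₀ : ℝ := N with hR₀def
  have hR₀ : 0 < R₀ := hN
  -- the cutoff field (equal to `U` on `ball 0 (N+1)`)
  obtain ⟨V, hV, ⟨M, hVM⟩, -, ⟨K, hK⟩, hagree⟩ := exists_cutoff_local hU2 (R := R₀ + 1) (by linarith)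
  have hV1 : ContDiff ℝ 1 V := hV.of_le (by norm_num)
  have hnear : ∀ z : EuclideanSpace ℝ (Fin 3), ‖z‖ ≤ R₀ → V =ᶠ[𝓝 z] U := by
    intro z hz
    have hmem : ball (0 : EuclideanSpace ℝ (Fin 3)) (R₀ + 1) ∈ 𝓝 z :=
      isOpen_ball.mem_nhds (by rw [mem_ball, dist_zero_right]; linarith)
    exact Filter.eventually_of_mem hmem fun y hy => hagree y hy
  have hDeq : ∀ z : EuclideanSpace ℝ (Fin 3), ‖z‖ ≤ R₀ → fderiv ℝ V z = fderiv ℝ U z :=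
    fun z hz => (hnear z hz).fderiv_eq
  have hcurlEq : ∀ z : EuclideanSpace ℝ (Fin 3), ‖z‖ ≤ R₀ → curl V z = curl U z :=
    fun z hz => curl_congr_fderiv (hDeq z hz)
  have hWeq : ∀ z : EuclideanSpace ℝ (Fin 3), ‖z‖ < R₀ + 1 →
      selfSimilarTransport γ 0 V z = selfSimilarTransport γ 0 U z := by
    intro z hz
    simp only [selfSimilarTransport_apply, hagree z (by rwa [mem_ball, dist_zero_right])]
  set Φ := ODE.evolutionMap (fun _ : ℝ => selfSimilarTransport γ 0 V) 0 with hΦ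
  -- the bad set of `V` inside the closed ball `R₀`
  set Bd : Set (EuclideanSpace ℝ (Fin 3)) := {z | z ∈ selfSimilarNodalSet γ 0 V ∧ ‖z‖ ≤ R₀ ∧
    ∃ w : EuclideanSpace ℝ (Fin 3), ‖w‖ = 1 ∧ 1 ≤ ⟪fderiv ℝ V z w, w⟫} with hBd
  have hBc : IsCompact Bd := by
    have hWc : Continuous (selfSimilarTransport γ 0 V) := (contDiff_selfSimilarTransport (γ := γ) hV).continuous
    have h1 : IsClosed (selfSimilarNodalSet γ 0 V) := isClosed_eq hWc continuous_const
    have h2 : IsClosed {z : EuclideanSpace ℝ (Fin 3) | ‖z‖ ≤ R₀} := isClosed_le continuous_norm continuous_const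
    have h3 := isClosed_badSet_of_contDiff hV1
    have hcl : IsClosed Bd := by
      rw [hBd, setOf_and, setOf_and]
      exact h1.inter (h2.inter h3)
    refine (isCompact_closedBall (0 : EuclideanSpace ℝ (Fin 3)) R₀).of_isClosed_subset hcl fun z hz => ?_
    rw [mem_closedBall, dist_zero_right]; exact hz.2.1
  -- every point of `Bd` is thin for the `V`-flow
  have hthin : ∀ z ∈ Bd, ∃ T : ℝ, 0 < T ∧ ∃ r : ℝ, 0 < r ∧ volume {q : EuclideanSpace ℝ (Fin 3) |
      ∃ qs : ℕ → EuclideanSpace ℝ (Fin 3), qs 0 = q ∧ (∀ k, Φ T (qs (k + 1)) = qs k) ∧ ∀ k, qs k ∈ ball z r} = 0 := by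
    rintro z ⟨hzN, hzR, hbad⟩
    by_cases hc : curl V z = 0
    · -- non-vortical: block data from the true profile `U`, transported by `DV z = DU z`
      have hcU : curl U z = 0 := by rwa [hcurlEq z hzR] at hc
      have hbadU : ∃ w : EuclideanSpace ℝ (Fin 3), ‖w‖ = 1 ∧ 1 ≤ ⟪fderiv ℝ U z w, w⟫ := by
        rw [← hDeq z hzR]; exact hbad
      obtain ⟨b, lam, β, hA0, hA1, hA2, hshape⟩ :=
        exists_thinBlock_of_curl_eq_zero_of_bad (hU1.differentiable one_ne_zero) hprof.divFree hγ2 hcU hbadU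
      rw [← hDeq z hzR] at hA0 hA1 hA2
      rcases hshape with ⟨h2, h20, h21⟩ | ⟨h0, h1, h02, h12⟩
      · exact C2.Kelvin.exists_trappedSet_null_of_dominatedBlock hV hK hzN b lam β hA0 hA1 hA2 h2 h20 h21
      · exact C2.Kelvin.exists_trappedSet_null_of_contractingPlane hV hK hzN b lam β hA0 hA1 hA2 h0 h1 h02 h12
    · -- vortical: pointwise profile facts from `U`
      have hzNU : z ∈ selfSimilarNodalSet γ 0 U := by
        rw [mem_selfSimilarNodalSet_iff] at hzN ⊢
        have := hWeq z (by linarith)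
        simp only [selfSimilarTransport_apply] at this
        rwa [this] at hzN
      have heig : fderiv ℝ V z (curl V z) = curl V z := by
        rw [hDeq z hzR, hcurlEq z hzR]
        exact hprof.isSelfSimilarEulerVorticityProfile.fderiv_apply_curl_eq_of_mem_nodalSet hzNU
      have hdivz : LinearMap.trace ℝ _ ((fderiv ℝ V z : EuclideanSpace ℝ (Fin 3) →L[ℝ] EuclideanSpace ℝ (Fin 3)) :
          EuclideanSpace ℝ (Fin 3) →ₗ[ℝ] EuclideanSpace ℝ (Fin 3)) = 0 := by
        rw [hDeq z hzR]; exact hprof.divFree z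
      exact exists_trappedSet_null_of_curl_ne_zero_loc hV hK (by linarith) hγ2 hzN hc heig hdivz
  have hnull := C2.Kelvin.volume_setOf_tendsto_flow_atBot_mem_eq_zero_of_trappedSets hV hK hBc hthin
  -- every vortical point with a backward half-orbit confined to `closedBall 0 N` flows backward into `Bd`
  refine measure_mono_null ?_ hnull
  rintro x ⟨hcx, Y, hY0, hYU, hYN⟩
  -- the globally defined `V`-orbit `Yp t = Φ_{−t} x`
  set Yp : ℝ → EuclideanSpace ℝ (Fin 3) := fun t => Φ (-t) x with hYp
  have hYpV : ∀ t, HasDerivAt Yp ((-1 : ℝ) • selfSimilarTransport γ 0 V (Yp t)) t :=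
    fun t => C2.Kelvin.hasDerivAt_flow_neg (γ := γ) hV1 hK x t
  have hYpc : Continuous Yp := continuous_iff_continuousAt.2 fun t => (hYpV t).continuousAt
  have hYp0 : Yp 0 = x := by simp [hYp, hΦ, ODE.evolutionMap_self]
  -- ODE uniqueness inside the ball: `Y = Yp` on `[0, ∞)`
  have hYV : ∀ t, 0 ≤ t → HasDerivAt Y ((-1 : ℝ) • selfSimilarTransport γ 0 V (Y t)) t := by
    intro t ht
    have h := hYU t ht
    rwa [← hWeq (Y t) (by linarith [hYN t ht])] at h
  have hL := C2.Kelvin.lipschitzWith_selfSimilarTransport (γ := γ) hV1 hK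
  have hLneg : LipschitzWith (Real.toNNReal (|γ| + K)) (fun y => (-1 : ℝ) • selfSimilarTransport γ 0 V y) :=
    LipschitzWith.of_dist_le_mul fun a b => by
      rw [neg_one_smul, neg_one_smul, dist_neg_neg]
      exact hL.dist_le_mul a b
  have hEq : ∀ t, 0 ≤ t → Y t = Yp t := by
    intro t ht
    have key := ODE_solution_unique (v := fun _ y => (-1 : ℝ) • selfSimilarTransport γ 0 V y)
      (f := Y) (g := Yp) (a := 0) (b := t) (K := Real.toNNReal (|γ| + K)) (fun _ => hLneg)
      (fun s hs => (hYV s hs.1).continuousAt.continuousWithinAt)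
      (fun s hs => (hYV s hs.1).hasDerivWithinAt)
      (hYpc.continuousOn) (fun s _ => (hYpV s).hasDerivWithinAt) (by rw [hY0, hYp0])
    exact key ⟨ht, le_rfl⟩
  have hconf : ∀ t, 0 ≤ t → ‖Yp t‖ ≤ R₀ := fun t ht => by rw [← hEq t ht]; exact hYN t ht
  have hYpU : ∀ t, 0 ≤ t → HasDerivAt Yp ((-1 : ℝ) • selfSimilarTransport γ 0 U (Yp t)) t := by
    intro t ht
    have h := hYpV t
    rwa [hWeq (Yp t) (by linarith [hconf t ht])] at h
  have hx0 : curl U (Yp 0) ≠ 0 := by rw [hYp0]; exact hcx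
  -- the limit-set kill on the half-orbit
  obtain ⟨z', hz'N, hz'R, hcl', w, hw, hbadw⟩ :=
    NodalContinuum.exists_mapClusterPt_stretching_ge_one_of_Ici hprof hγne hYpc hYpU hconf hx0
  have hcl : MapClusterPt z' atBot (fun s => Φ s x) := by
    have e : Yp = (fun s => Φ s x) ∘ Neg.neg := rfl
    have hclYp : MapClusterPt z' atTop Yp := hcl'
    rw [e, mapClusterPt_comp, Filter.map_neg_atTop] at hclYp
    exact hclYp
  -- point hypotheses from the profile along the half-orbit
  have htendsYp : Tendsto (fun t => selfSimilarTransport γ 0 V (Yp t)) atTop (𝓝 0) := by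
    have h := HalfOrbit.tendsto_transport_comp_of_bounded_of_Ici hprof hγne (σ := -1) (by norm_num) hYpc hYpU hconf
    refine h.congr' ((eventually_ge_atTop (0 : ℝ)).mono fun t ht => ?_)
    show selfSimilarTransport γ 0 U (Yp t) = selfSimilarTransport γ 0 V (Yp t)
    rw [hWeq (Yp t) (by linarith [hconf t ht])]
  have htends : Tendsto (fun s => selfSimilarTransport γ 0 V (Φ s x)) atBot (𝓝 0) := by
    have h := htendsYp.comp tendsto_neg_atBot_atTop
    refine h.congr fun s => ?_
    simp only [Function.comp_apply, hYp, neg_neg]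
  obtain ⟨C, hC⟩ := HalfOrbit.exists_integral_norm_transport_sq_le_of_Ici hprof hγne (σ := -1) (by norm_num)
    hYpc hYpU hconf
  have hcont : Continuous fun t : ℝ => ‖selfSimilarTransport γ 0 V (Φ (-t) x)‖ ^ 2 :=
    ((((contDiff_selfSimilarTransport (γ := γ) hV).continuous.comp
      ((C2.Kelvin.continuous_flow_apply (γ := γ) hV1 hK x).comp continuous_neg)).norm).pow 2)
  have hint : IntegrableOn (fun t : ℝ => ‖selfSimilarTransport γ 0 V (Φ (-t) x)‖ ^ 2) (Ioi 0) := by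
    refine integrableOn_Ioi_of_intervalIntegral_norm_bounded C 0 (l := atTop) (b := fun n : ℕ => (n : ℝ))
      (fun n => (hcont.integrableOn_Icc).mono_set Ioc_subset_Icc_self) tendsto_natCast_atTop_atTop ?_
    refine Eventually.of_forall fun n => ?_
    have h := hC 0 n le_rfl (Nat.cast_nonneg n)
    refine le_trans (le_of_eq ?_) h
    refine intervalIntegral.integral_congr fun t ht => ?_
    rw [uIcc_of_le (Nat.cast_nonneg n)] at ht
    simp only [Real.norm_eq_abs, abs_pow, abs_norm]
    rw [hWeq (Yp t) (by linarith [hconf t ht.1])]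
  -- node facts at `z'`
  have hDz : fderiv ℝ V z' = fderiv ℝ U z' := hDeq z' hz'R
  have hz'NV : z' ∈ selfSimilarNodalSet γ 0 V := by
    rw [mem_selfSimilarNodalSet_iff] at hz'N ⊢
    have := hWeq z' (by linarith)
    simp only [selfSimilarTransport_apply] at this
    rwa [← this] at hz'N
  have hdiv0 : LinearMap.trace ℝ _ ((fderiv ℝ V z' : EuclideanSpace ℝ (Fin 3) →L[ℝ] EuclideanSpace ℝ (Fin 3)) :
      EuclideanSpace ℝ (Fin 3) →ₗ[ℝ] EuclideanSpace ℝ (Fin 3)) = 0 := by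
    rw [hDz]; exact hprof.divFree z'
  have heig : curl V z' ≠ 0 → fderiv ℝ V z' (curl V z') = curl V z' := fun _ => by
    rw [hDz, hcurlEq z' hz'R]
    exact hprof.isSelfSimilarEulerVorticityProfile.fderiv_apply_curl_eq_of_mem_nodalSet hz'N
  have hbadV : 1 ≤ ⟪fderiv ℝ V z' w, w⟫ := by rw [hDz]; exact hbadw
  obtain ⟨z, hzN, hz⟩ := tendsto_flow_atBot_of_badClusterPt_loc hV hK hVM hγ hγ2 x htends hint hcl hdiv0 heig hw hbadV
  have hzz' : z' = z := eq_of_nhds_neBot (hcl.clusterPt.mono hz)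
  exact ⟨z, ⟨hzN, hzz' ▸ hz'R, w, hw, hzz' ▸ hbadV⟩, hz⟩

/-- **VORTICAL POINTS WITH A BOUNDED BACKWARD ORBIT ARE NULL** (`∃ N` form): in a `C²` self-similar Euler profile with
`0 < γ < ½`, the set of points with `curl U x ≠ 0` admitting a bounded backward half-orbit of `W = γy + U` has Lebesgue
measure zero. [folklore] -/
theorem volume_vortical_boundedBackward_eq_zero (hprof : IsSelfSimilarEulerProfile γ 0 U P)
    (hγ : 0 < γ) (hγ2 : γ < 1 / 2) :
    volume {x : EuclideanSpace ℝ (Fin 3) | curl U x ≠ 0 ∧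
      ∃ Y : ℝ → EuclideanSpace ℝ (Fin 3), Y 0 = x ∧
        (∀ t, 0 ≤ t → HasDerivAt Y ((-1 : ℝ) • selfSimilarTransport γ 0 U (Y t)) t) ∧
        ∃ N : ℝ, ∀ t, 0 ≤ t → ‖Y t‖ ≤ N} = 0 := by
  have hsub : {x : EuclideanSpace ℝ (Fin 3) | curl U x ≠ 0 ∧
      ∃ Y : ℝ → EuclideanSpace ℝ (Fin 3), Y 0 = x ∧
        (∀ t, 0 ≤ t → HasDerivAt Y ((-1 : ℝ) • selfSimilarTransport γ 0 U (Y t)) t) ∧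
        ∃ N : ℝ, ∀ t, 0 ≤ t → ‖Y t‖ ≤ N} ⊆
      ⋃ n : ℕ, {x : EuclideanSpace ℝ (Fin 3) | curl U x ≠ 0 ∧
        ∃ Y : ℝ → EuclideanSpace ℝ (Fin 3), Y 0 = x ∧
          (∀ t, 0 ≤ t → HasDerivAt Y ((-1 : ℝ) • selfSimilarTransport γ 0 U (Y t)) t) ∧
          ∀ t, 0 ≤ t → ‖Y t‖ ≤ (n : ℝ) + 1} := by
    rintro x ⟨hcx, Y, hY0, hYU, N, hYN⟩
    obtain ⟨n, hn⟩ := exists_nat_ge N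
    exact mem_iUnion.2 ⟨n, hcx, Y, hY0, hYU, fun t ht => (hYN t ht).trans (hn.trans (by linarith))⟩
  refine measure_mono_null hsub (measure_iUnion_null fun n => ?_)
  exact volume_vortical_confined_eq_zero hprof hγ hγ2 (N := (n : ℝ) + 1) (by positivity)

/-- **A.e. vortical fluid particle comes from infinity**: for almost every `x`, if `curl U x ≠ 0` then NO backward
half-orbit of `W = γy + U` from `x` is bounded. [folklore] -/
theorem ae_not_boundedBackward_of_curl_ne_zero (hprof : IsSelfSimilarEulerProfile γ 0 U P)
    (hγ : 0 < γ) (hγ2 : γ < 1 / 2) :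
    ∀ᵐ x : EuclideanSpace ℝ (Fin 3) ∂volume, curl U x ≠ 0 →
      ∀ Y : ℝ → EuclideanSpace ℝ (Fin 3), Y 0 = x →
        (∀ t, 0 ≤ t → HasDerivAt Y ((-1 : ℝ) • selfSimilarTransport γ 0 U (Y t)) t) →
        ∀ N : ℝ, ∃ t, 0 ≤ t ∧ N < ‖Y t‖ := by
  have h := volume_vortical_boundedBackward_eq_zero hprof hγ hγ2
  rw [← compl_mem_ae_iff] at h
  filter_upwards [h] with x hx
  intro hcx Y hY0 hYU N
  by_contra hcon
  push Not at hcon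
  exact hx ⟨hcx, Y, hY0, hYU, N, hcon⟩

end Summit.NavierStokesRegularity.NavierStokesRegularity.Theorems.PowerGaugeEulerLiouville.Loc

end
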